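import Summits.ABC.ABC.Theses.CuspFieldPencil
import Summits.ABC.ABC.Theorems.GoldenFieldClassNumberOne
import Literature.Barriers.ABC.BakerMethodBounds
import Literature.NumberTheory.DiophantineGeometry.Matveev2000LinearFormsLogNumberField
import Literature.NumberTheory.DiophantineGeometry.MatveevYuPlaceBoundsNumberField
import Literature.NumberTheory.DiophantineGeometry.AbcTwoAdicValuationProofs
import Literature.NumberTheory.EllipticCurves.HeightsBaseChangeProofs
import Summits.ABC.ABC.Theorems.CuspFieldPencilGoldenFromNFPencil

/-! Sketch (planner, stub-ideation k3 **g3**, family 3 = PROBE THE EXTREMES) for `stub_conjugateCuspTriple`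
(crux stmt-ABC-26026 `GoldenCuspShadow`). Statements only (`sorry` bodies) except `ring`/`norm_num` sanity.

WHAT IS NEW IN g3. The stub's surplus over the unconditional ℚ-line `UWMinP` (g2) is ISOLATED as one integer-facing
statement `QSideRad` ("`log H ≪_ε R^ε · rad Q`"), which is EXACTLY the datum the golden field `K = ℚ(√5)` adds:
`Q = N_{K/ℚ}(u − φ⁵ w)` and the element `x₊ = u − φ⁵ w ∈ ℤ[5φ]` replaces the junk members `u − 11w`, `11u + w` of the
rational Cassini identities. `QSideRad` splits into an archimedean half `QNotSmall` (Matveev over `K` at the real place,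
mod `matveev2000_linearFormsLog_nf`) and a non-archimedean half `QUpper` (Yu over `K` at the split primes of `Q`, mod
`yu2007_padicLogForm_logB_nf`). Assemblies: `UWMinP ∧ QSideRad ⇒ stub` (Q2) and `UWMinP ∧ QSideRad ⇒ GoldenThird`
(exponent 1/3, Q3) — i.e. the K-datum buys the crux at exponent `1/3 + ε` with κ depending on nothing but ε.
E1–E3: the extremal structure (automorph / Cassini pair / unit orbit) behind the residual regime of g2.
Λ-FORM: both load-bearing steps (Q4d, Q5c) are DIRECT INSTANCES of the tree's PROVED place bounds
`Dioph.evertseGyory2022_prop_4_2_4_infinite_nf_of_matveev` / `…_finite_nf_of_yu` with `α ∈ {−1} ∪ {p | uw} ∪ {ω}` —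
no generators of prime ideals of `𝓞_K`, no unit bookkeeping beyond `ω`, heights of rational primes only. -/

set_option linter.dupNamespace false

namespace Summit.ABC.ABC.Cruxes.GoldenCuspShadow.ConjugateK3G3

open UniqueFactorizationMonoid Literature.Barriers.ABC NumberField QuadraticAlgebra Height
open Summit.ABC.ABC.Theses.CuspFieldPencil
open Literature.NumberTheory.DiophantineGeometry.Dioph (matveev2000_linearFormsLog_nf yu2007_padicLogForm_logB_nf)

/-! ### 0 · The statements -/

/-- The registered stub signature, verbatim (payload.stub.signature). -/
def SigStubConjugateCuspTriple : Prop :=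
  ∀ ε : ℝ, 0 < ε → ∃ κ : ℝ, ∀ u w : ℤ, IsCoprime u w → u * w * (u ^ 2 - 11 * u * w - w ^ 2) ≠ 0 → Real.log (max (|(u : ℝ)|) (|(w : ℝ)|)) ≤ κ * (((UniqueFactorizationMonoid.radical (u * w * (u ^ 2 - 11 * u * w - w ^ 2))).natAbs : ℕ) : ℝ) ^ (ε : ℝ) * ((((UniqueFactorizationMonoid.radical (u ^ 2 - 11 * u * w - w ^ 2)).natAbs : ℕ) : ℝ) ^ (2 / 3 : ℝ) * (min (((UniqueFactorizationMonoid.radical u).natAbs : ℕ) : ℝ) (((UniqueFactorizationMonoid.radical w).natAbs : ℕ) : ℝ)) ^ (2 / 3 : ℝ))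

/-- G0 of g2, verbatim: the unconditional ℚ-line statement `log H ≤ κ_ε R^ε · min(P u, P w)`. -/
def UWMinP : Prop :=
  ∀ ε : ℝ, 0 < ε → ∃ κ : ℝ, ∀ u w : ℤ, IsCoprime u w → u * w * (u ^ 2 - 11 * u * w - w ^ 2) ≠ 0 →
    Real.log (max (|(u : ℝ)|) (|(w : ℝ)|)) ≤
      κ * (((radical (u * w * (u ^ 2 - 11 * u * w - w ^ 2))).natAbs : ℕ) : ℝ) ^ (ε : ℝ) *
        (min (largestPrimeFactor u.natAbs) (largestPrimeFactor w.natAbs) : ℕ)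

/-- Q0 (the K-DATUM, integer-facing): `log H ≤ κ_ε · R^ε · rad(Q)`. -/
def QSideRad : Prop :=
  ∀ ε : ℝ, 0 < ε → ∃ κ : ℝ, ∀ u w : ℤ, IsCoprime u w → u * w * (u ^ 2 - 11 * u * w - w ^ 2) ≠ 0 →
    Real.log (max (|(u : ℝ)|) (|(w : ℝ)|)) ≤
      κ * (((radical (u * w * (u ^ 2 - 11 * u * w - w ^ 2))).natAbs : ℕ) : ℝ) ^ (ε : ℝ) *
        (((radical (u ^ 2 - 11 * u * w - w ^ 2)).natAbs : ℕ) : ℝ)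

/-- Q0′ (archimedean half, K-arch): `2 log H ≤ log |Q| + κ_δ rad(uw)^δ · log(2 + log H)`
("`|Q|` is never much smaller than `H²`": `min(|x₊|,|x₋|) ≥ H^{1-o(1)}`). -/
def QNotSmall : Prop :=
  ∀ δ : ℝ, 0 < δ → ∃ κ : ℝ, ∀ u w : ℤ, IsCoprime u w → u * w * (u ^ 2 - 11 * u * w - w ^ 2) ≠ 0 →
    2 * Real.log (max (|(u : ℝ)|) (|(w : ℝ)|)) ≤
      Real.log (|((u ^ 2 - 11 * u * w - w ^ 2 : ℤ) : ℝ)|) +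
        κ * (((radical (u * w)).natAbs : ℕ) : ℝ) ^ δ *
          Real.log (2 + Real.log (max (|(u : ℝ)|) (|(w : ℝ)|)))

/-- Q0″ (non-archimedean half, K-adic): `log |Q| ≤ κ_δ rad(uw)^δ · rad(Q) · log(2 + log H)`
("`Q` is never very powerful": `Σ_{p | Q} v_p(Q) log p ≪ rad(Q) · (log log H) · rad(uw)^δ`). -/
def QUpper : Prop :=
  ∀ δ : ℝ, 0 < δ → ∃ κ : ℝ, ∀ u w : ℤ, IsCoprime u w → u * w * (u ^ 2 - 11 * u * w - w ^ 2) ≠ 0 →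
    Real.log (|((u ^ 2 - 11 * u * w - w ^ 2 : ℤ) : ℝ)|) ≤
      κ * (((radical (u * w)).natAbs : ℕ) : ℝ) ^ δ *
        (((radical (u ^ 2 - 11 * u * w - w ^ 2)).natAbs : ℕ) : ℝ) *
          Real.log (2 + Real.log (max (|(u : ℝ)|) (|(w : ℝ)|)))

/-- The crux at exponent `1/3 + ε` (what `UWMinP ∧ QSideRad` buys; the route's crux has `1/2 + ε`). -/
def GoldenThird : Prop :=
  ∀ ε : ℝ, 0 < ε → ∃ κ : ℝ, ∀ u w : ℤ, IsCoprime u w → u * w * (u ^ 2 - 11 * u * w - w ^ 2) ≠ 0 →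
    Real.log (max (|(u : ℝ)|) (|(w : ℝ)|)) ≤
      κ * (((radical (u * w * (u ^ 2 - 11 * u * w - w ^ 2))).natAbs : ℕ) : ℝ) ^ (1 / 3 + ε : ℝ)

/-! ### 1 · Elementary assemblies (real arithmetic) -/

/-- Q1a (S, self-improvement): `x ≤ A log(2 + x)` ⇒ `x ≤ 2A log(A + 11)`
(`x − A log(2+x)` increases on `[A−2, ∞)`; at `x₀ = 2A log(A+11)`: `2 + x₀ ≤ (A+11)²` via `log t ≤ √t`). -/
theorem selfImprove {x A : ℝ} (hx : 0 ≤ x) (hA : 1 ≤ A) (h : x ≤ A * Real.log (2 + x)) :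
    x ≤ 2 * A * Real.log (A + 11) := by
  sorry

/-- Q1 (S): the two halves give the K-datum: add `Q0′`, `Q0″` (with `δ = ε/3`), bound `rad(uw)^δ ≤ R^δ`,
`rad Q ≥ 1`, then `selfImprove` with `A = κ R^δ rad Q` and `log(A + 11) ≪_δ R^δ` (`Real.log_le_rpow_div`). -/
theorem qSideRad_of_qNotSmall_of_qUpper (h₁ : QNotSmall) (h₂ : QUpper) : QSideRad := by
  sorry

/-- Q2a (XS): `1 ≤ m`, `0 ≤ q` ⇒ `min m q ≤ q^{2/3} m^{2/3}` (`min ≤ q^{2/3} m^{1/3}` and `m^{1/3} ≤ m^{2/3}`). -/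
theorem min_le_rpow_mul_rpow {m q : ℝ} (hm : 1 ≤ m) (hq : 0 ≤ q) :
    min m q ≤ q ^ (2 / 3 : ℝ) * m ^ (2 / 3 : ℝ) := by
  sorry

/-- Q2 (S): `UWMinP ∧ QSideRad ⇒ THIS STUB`: `log H ≤ κ R^ε min(min(P u, P w), rad Q)`,
`min(P u, P w) ≤ m := min(rad u, rad w)` (g2 G4 `largestPrimeFactor_le_natAbs_radical`), then Q2a with `q = rad Q`. -/
theorem sig_of_uwMinP_of_qSideRad (h₁ : UWMinP) (h₂ : QSideRad) : SigStubConjugateCuspTriple := by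
  sorry

/-- Q3a (XS): `min(a, b, c) ≤ (abc)^{1/3}` for `a, b, c ≥ 0`. -/
theorem min_three_le_rpow {a b c : ℝ} (ha : 0 ≤ a) (hb : 0 ≤ b) (hc : 0 ≤ c) :
    min (min a b) c ≤ (a * b * c) ^ (1 / 3 : ℝ) := by
  sorry

/-- Q3 (S): `UWMinP ∧ QSideRad ⇒ GoldenThird`: `min(P u, P w, rad Q) ≤ (rad u · rad w · rad Q)^{1/3} = R^{1/3}`
(Q3a, G4, `GoldenFromNFPencil.natAbs_radical_prod`), `R^ε R^{1/3} = R^{1/3+ε}` (`Real.rpow_add`). -/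
theorem goldenThird_of_uwMinP_of_qSideRad (h₁ : UWMinP) (h₂ : QSideRad) : GoldenThird := by
  sorry

/-- Q3′ (XS): `GoldenThird ⇒ GoldenCuspShadow` (`R ≥ 1`, `1/3 + ε ≤ 1/2 + ε`, `Real.rpow_le_rpow_of_exponent_le`). -/
theorem goldenCuspShadow_of_goldenThird (h : GoldenThird) : GoldenCuspShadow := by
  sorry

/-! ### 2 · The archimedean half `QNotSmall` (Matveev over `K = ℚ(√5)` at the real place `ω ↦ φ`) -/

/-- Q4a (XS, conjugate geometry): with `x₊ = u − φ⁵w`, `x₋ = u + φ⁻⁵w` (`φ⁵ + φ⁻⁵ = 5√5`, `φ⁵ − φ⁻⁵ = 11`):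
`max(|u|,|w|) ≤ max(|x₊|,|x₋|)` (`5√5·u = φ⁻⁵x₊ + φ⁵x₋`, `5√5·w = x₋ − x₊`). -/
theorem max_abs_le_max_conj (u w : ℝ) :
    max |u| |w| ≤ max |u - Real.goldenRatio ^ 5 * w| |u + (Real.goldenRatio⁻¹) ^ 5 * w| := by
  sorry

/-- Q4b (XS, dichotomy): `|u|/2 ≤ |x₊|` or `|u|/2 ≤ φ⁵|w|` (triangle inequality); likewise
`|u|/2 ≤ |x₋|` or `|u|/2 ≤ φ⁻⁵|w|`. With Q4c this gives `log|x_±| ≥ log H − O(1) − T` where `T` is the LFL term of Q4d. -/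
theorem conj_dichotomy (u w : ℝ) :
    (|u| / 2 ≤ |u - Real.goldenRatio ^ 5 * w| ∨ |u| / 2 ≤ Real.goldenRatio ^ 5 * |w|) ∧
      (|u| / 2 ≤ |u + (Real.goldenRatio⁻¹) ^ 5 * w| ∨ |u| / 2 ≤ (Real.goldenRatio⁻¹) ^ 5 * |w|) := by
  sorry

/-- Q4c (XS, the Λ-form identities, `φ · φ⁻¹ = 1`): `x₊ = −φ⁵w · ((u/w)·φ⁻⁵ − 1)` and `x₋ = −φ⁻⁵w · ((−u/w)·φ⁵ − 1)`,
so `|x₊| = φ⁵|w|·|Λ₊|`, `|x₋| = φ⁻⁵|w|·|Λ₋|` with `Λ_± = ∏ α^b − 1` over `α ∈ {−1} ∪ {p | uw} ∪ {φ}`. -/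
theorem conj_lambda_form (u w : ℝ) (hw : w ≠ 0) :
    u - Real.goldenRatio ^ 5 * w = -(Real.goldenRatio ^ 5 * w) * (u / w * (Real.goldenRatio⁻¹) ^ 5 - 1) ∧
      u + (Real.goldenRatio⁻¹) ^ 5 * w =
        -((Real.goldenRatio⁻¹) ^ 5 * w) * (-u / w * Real.goldenRatio ^ 5 - 1) := by
  sorry

/-- Q4d (M−, THE LOAD-BEARING ARCHIMEDEAN STEP, mod Matveev-NF): for non-zero integers `u, w` and `s = ±5`,
`−log |(u/w)·φ^{−s}… − 1| ≤ κ_δ · rad(uw)^δ · log(2 + log H)` (Λ-form; if `u/w < 0` the left side is `≤ 0`).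
DIRECT INSTANCE of the tree's PROVED place bound `Dioph.evertseGyory2022_prop_4_2_4_infinite_nf_of_matveev hM`
(MatveevYuPlaceBoundsNumberField.lean:411) at `K = QuadraticAlgebra ℚ 1 1` (`Fact` ← `GoldenField.golden_fact`,
`GoldenField.numberField`, `GoldenField.finrank_eq_two`), `w₀ : InfinitePlace K` = `InfinitePlace.mk σ` for the real embedding
`σ = QuadraticAlgebra.lift ⟨φ, φ² = 1 + φ⟩` (`Real.goldenRatio_sq`; pattern `Literature/NumberTheory/QuadraticFields/Sqrt41.lean:σpos`),
`mult w₀ = 1`; `κ = Option ι` (`ι` = prime support of `|u|,|w|`, `card ≥ 2` unless `uw = ±1`, the finite set `H = 1`),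
`α none = ω`, `α (some p) = p`, `b (some p) = v_p(u) − v_p(w)`, `b none = −s`; `w₀(∏ α^b − 1) = |σ(…)| = |(u/w)φ^{−s} − 1|`;
`B = 3 + 2·log₂ H`; heights `logHeight₁ (p : K) = 2 log p` (`NumberField.logHeight₁_algebraMap` + `logHeight₁_natCast_prime`),
`logHeight₁ ω` = a constant of `K` (absorbed in κ, value never needed); absorption of `12(32e)^{3n+2} ∏_{p|uw} max(log p, m(2))`
into `rad(uw)^δ` by `exists_pow_card_primeFactors_le_mul_rpow` + `exists_prod_log_primeFactors_le_mul_rpow` (AbcTwoAdicValuationProofs). -/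
theorem matveevStep (hM : matveev2000_linearFormsLog_nf) :
    ∀ δ : ℝ, 0 < δ → ∃ κ : ℝ, ∀ u w : ℤ, u ≠ 0 → w ≠ 0 → ∀ s : ℤ, (s = 5 ∨ s = -5) →
      (u : ℝ) / w * Real.goldenRatio ^ s - 1 ≠ 0 →
      -Real.log (|(u : ℝ) / w * Real.goldenRatio ^ s - 1|) ≤
        κ * (((radical (u * w)).natAbs : ℕ) : ℝ) ^ δ * Real.log (2 + Real.log (max (|(u : ℝ)|) (|(w : ℝ)|))) := by
  sorry

/-- Q4 (S, assembly of Q4a–d): `QNotSmall` mod Matveev-NF. `log|Q| = log|x₊| + log|x₋| = log max + log min ≥ log H + log min`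
(Q4a); `log|x₊| = log(φ⁵|w|) + log|Λ₊| ≥ log|w| + 5 log φ − T` and, by Q4b, `≥ log|u| − log 2 − T`; same for `x₋`; so
`log min(|x₊|,|x₋|) ≥ log H − 5 log φ − log 2 − T`, `T = κ rad(uw)^δ log(2 + log H)` (Q4d; `Λ_± ≠ 0` as `φ⁵ ∉ ℚ`, `Real.goldenRatio_irrational`). -/
theorem qNotSmall_of_matveev (hM : matveev2000_linearFormsLog_nf) : QNotSmall := by
  sorry

/-! ### 3 · The non-archimedean half `QUpper` (Yu over `K` at the split primes of `Q`) -/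

section GoldenField

variable [Fact (∀ r : ℚ, r ^ 2 ≠ (1 : ℚ) + 1 * r)]

/-- Q5b (S/M, the valuation identity at a split prime): for coprime `u, w`, a prime `p ∤ 10` dividing `Q = N(x₊)`
splits in `K` (`5` is a square mod `p` since `(2u − 11w)² ≡ 125 w² (mod p)`, `p ∤ w`), `p` is coprime to `(x₊, x₋) ⊇ (5√5)`,
so exactly one prime `𝔭 | p` divides `x₊ = u + β₂ w` (`β₂ = −3 − 5θ = −φ⁵`) and `ord_𝔭(x₊) = v_p(Q)`, `e_𝔭 = 1`, `N𝔭 = p`. -/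
theorem exists_split_prime_ord_eq [NumberField (QuadraticAlgebra ℚ 1 1)]
    (θ : 𝓞 (QuadraticAlgebra ℚ 1 1))
    (hθ : θ = ⟨ω, Summit.ABC.ABC.Theorems.GoldenField.isIntegral_omega⟩)
    (u w : ℤ) (hcop : IsCoprime u w) (p : ℕ) (hp : p.Prime) (h10 : ¬ p ∣ 10)
    (hpQ : (p : ℤ) ∣ u ^ 2 - 11 * u * w - w ^ 2) (hQ : u ^ 2 - 11 * u * w - w ^ 2 ≠ 0) :
    ∃ 𝔭 : IsDedekindDomain.HeightOneSpectrum (𝓞 (QuadraticAlgebra ℚ 1 1)),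
      Ideal.absNorm 𝔭.asIdeal = p ∧ Literature.IUT.LogVolume.ramIdx (QuadraticAlgebra ℚ 1 1) 𝔭 = 1 ∧
      Literature.IUT.LogVolume.ord (QuadraticAlgebra ℚ 1 1) 𝔭
          (algebraMap (𝓞 (QuadraticAlgebra ℚ 1 1)) (QuadraticAlgebra ℚ 1 1)
            ((u : 𝓞 (QuadraticAlgebra ℚ 1 1)) + (-3 - 5 * θ) * (w : 𝓞 (QuadraticAlgebra ℚ 1 1)))) =
        (padicValInt p (u ^ 2 - 11 * u * w - w ^ 2) : ℤ) := by
  sorry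

end GoldenField

/-- Q5c (M, THE LOAD-BEARING NON-ARCHIMEDEAN STEP, mod Yu-NF): per prime `p | Q`, `p ∤ 10` (split in `K`):
`v_p(Q) ≤ κ_δ · rad(uw)^δ · p/(log p)² · log(2 + log H)`.
DIRECT INSTANCE of the tree's PROVED place bound `Dioph.evertseGyory2022_prop_4_2_4_finite_nf_of_yu hY`
(MatveevYuPlaceBoundsNumberField.lean:612) at `K`, the prime `𝔭 | x₊` over `p` of Q5b (`N𝔭 = p`), the same `α, b, B` as Q4d with
`Λ = (u/w)·ω⁻⁵ − 1`, `x₊ = u − ω⁵w = −ω⁵w·Λ`, `𝔭 ∤ wω` ⇒ `ord_𝔭 Λ = ord_𝔭 x₊ = v_p(Q)` (Q5b), and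
`log (adicAbv K 𝔭 Λ) = −ord_𝔭(Λ) · log N𝔭` (`Literature.IUT.LogVolume.adicAbv_eq_absNorm_zpow`): the printed
`−c₁₀(n,2)(N𝔭/log N𝔭) Ω log B < log|Λ|_𝔭` is `v_p(Q) log p < c₁₀ (p/log p) Ω log B`; `c₁₀ Ω` absorbed into `rad(uw)^δ` as in Q4d. -/
theorem yuStep (hY : yu2007_padicLogForm_logB_nf) :
    ∀ δ : ℝ, 0 < δ → ∃ κ : ℝ, ∀ u w : ℤ, IsCoprime u w → u * w * (u ^ 2 - 11 * u * w - w ^ 2) ≠ 0 →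
      ∀ p : ℕ, p.Prime → ¬ p ∣ 10 → (p : ℤ) ∣ u ^ 2 - 11 * u * w - w ^ 2 →
        (padicValInt p (u ^ 2 - 11 * u * w - w ^ 2) : ℝ) ≤
          κ * (((radical (u * w)).natAbs : ℕ) : ℝ) ^ δ * ((p : ℝ) / Real.log p ^ 2) *
            Real.log (2 + Real.log (max (|(u : ℝ)|) (|(w : ℝ)|))) := by
  sorry

/-- Q5d (XS): `Σ_{p | n} p ≤ ∏_{p | n} p` (all prime factors are `≥ 2`; `a + b ≤ ab` for `a, b ≥ 2`). -/
theorem sum_primeFactors_le_prod (n : ℕ) :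
    ∑ p ∈ n.primeFactors, (p : ℝ) ≤ ∏ p ∈ n.primeFactors, (p : ℝ) := by
  sorry

/-- Q5e (XS, local shape of `Q` at `2` and `5`, cf. g2 G6): for coprime `u, w`: `2 ∤ Q` and `5⁴ ∤ Q`. -/
theorem two_not_dvd_Q (u w : ℤ) (hcop : IsCoprime u w) : ¬ (2 : ℤ) ∣ u ^ 2 - 11 * u * w - w ^ 2 := by
  sorry

/-- Q5 (S, assembly): `QUpper` mod Yu-NF: `log|Q| = Σ_{p|Q} v_p(Q) log p ≤ 3 log 5 + Σ_{p|Q, p∤10} (Q5c)·log p`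
(Q5e, g2 G6 `five_pow_four_not_dvd_Q`), `Σ_{p|Q} p/log p ≤ (1/log 3)·rad Q` (Q5d, `Nat.radical_eq_prod_primeFactors`). -/
theorem qUpper_of_yu (hY : yu2007_padicLogForm_logB_nf) : QUpper := by
  sorry

/-! ### 4 · Net statements for the lead -/

/-- THIS STUB mod the two NF facts, via the K-datum and the unconditional ℚ-line (Q1, Q2, Q4, Q5; `UWMinP` = k2 g2 Plan A). -/
theorem sig_of_facts (hU : UWMinP) (hM : matveev2000_linearFormsLog_nf) (hY : yu2007_padicLogForm_logB_nf) :
    SigStubConjugateCuspTriple :=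
  sig_of_uwMinP_of_qSideRad hU (qSideRad_of_qNotSmall_of_qUpper (qNotSmall_of_matveev hM) (qUpper_of_yu hY))

/-- The exponent-1/3 crux mod the same two facts. -/
theorem goldenThird_of_facts (hU : UWMinP) (hM : matveev2000_linearFormsLog_nf)
    (hY : yu2007_padicLogForm_logB_nf) : GoldenThird :=
  goldenThird_of_uwMinP_of_qSideRad hU (qSideRad_of_qNotSmall_of_qUpper (qNotSmall_of_matveev hM) (qUpper_of_yu hY))

/-! ### 5 · Extremal structure (family 3): the automorph, the Cassini pair, the unit orbit -/

/-- E1 (sanity, `ring`): the automorph `(u, w) ↦ (11u + w, u)` of the cusp form (multiplication of `x₊` by the unit `φ^{∓5}`,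
`N(φ⁵) = −1`): `Q(11u + w, u) = −Q(u, w)`; its orbits are the recurrences `s_{j+1} = 11 s_j + s_{j−1}`. -/
theorem quadForm_automorph (u w : ℤ) :
    (11 * u + w) ^ 2 - 11 * (11 * u + w) * u - u ^ 2 = -(u ^ 2 - 11 * u * w - w ^ 2) := by
  ring

/-- E2 (sanity, `ring`): the two Cassini identities at the available pair = the rational triples `T_u`, `T_w` behind `UWMinP`;
their third members `u − 11w = −s_{j−1}`, `11u + w = s_{j+2}` are the NEIGHBOURING orbit terms (junk radical `≍ H`). -/
theorem cassini_pair (u w : ℤ) :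
    u * (u - 11 * w) = (u ^ 2 - 11 * u * w - w ^ 2) + w ^ 2 ∧
      w * (11 * u + w) = u ^ 2 - (u ^ 2 - 11 * u * w - w ^ 2) := by
  constructor <;> ring

/-- E3 (sanity, `norm_num`): the unit orbit `(F_{5k+5}/5, F_{5k}/5)` — `(11,1), (122,11), (1353,122)` — has `Q = ∓1`:
the residual regime `rad Q < min(rad u, rad w)^{1/2}` of g2 is non-empty and infinite (here `rad Q = 1`). -/
theorem unit_orbit_examples :
    (11 : ℤ) ^ 2 - 11 * 11 * 1 - 1 ^ 2 = -1 ∧ (122 : ℤ) ^ 2 - 11 * 122 * 11 - 11 ^ 2 = 1 ∧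
      (1353 : ℤ) ^ 2 - 11 * 1353 * 122 - 122 ^ 2 = -1 := by
  norm_num

/-! ### 6 · Name certificates: the tree theorems Plan Q instantiates (elaboration = the names resolve) -/

example := @Literature.NumberTheory.DiophantineGeometry.Dioph.evertseGyory2022_prop_4_2_4_infinite_nf_of_matveev
example := @Literature.NumberTheory.DiophantineGeometry.Dioph.evertseGyory2022_prop_4_2_4_finite_nf_of_yu
example := @Literature.IUT.LogVolume.adicAbv_eq_absNorm_zpow
example := @NumberField.logHeight₁_algebraMap
example := @Literature.NumberTheory.DiophantineGeometry.Pasten.logHeight₁_natCast_prime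
example := @Literature.NumberTheory.DiophantineGeometry.exists_pow_card_primeFactors_le_mul_rpow
example := @Literature.NumberTheory.DiophantineGeometry.exists_prod_log_primeFactors_le_mul_rpow
example := @Summit.ABC.ABC.Theorems.GoldenField.ringOfIntegers_isPrincipalIdealRing
example := @Summit.ABC.ABC.Theorems.GoldenField.finrank_eq_two
example := @Summit.ABC.ABC.Theorems.GoldenFromNFPencil.natAbs_radical_prod
example := @Real.goldenRatio_irrational
example := @Real.log_le_rpow_div

end Summit.ABC.ABC.Cruxes.GoldenCuspShadow.ConjugateK3G3
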